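import Summits.MatrixMultiplication.MatrixMultiplication.Theorems.AbelianSTPPCensusTAStatFDefs
import Summits.MatrixMultiplication.MatrixMultiplication.Theorems.AbelianSTPPCensusTAStatKMemberXWalk5
import Summits.MatrixMultiplication.MatrixMultiplication.Theorems.AbelianSTPPCensusTB5StatSplit

/-!
# T_A static certificate, range `6780 … 6833` (multi-parameter k-member tree at `τ = 2371/1000`): glue for the root-split kernel layout

Cell mm-stpp (rung F-M1), tier T_A = «beat `2.371`, the record exponent (ADVXXZ'25 / DEK+26 rounded)»; seat mm-stpp-vp-p2 (gen 7).  In this range single (cell, order) trees of the k-member tree exceed one `decide` (cells `(15,15,18)` / `(14,17,17)` / `(15,16,17)` / `(12,17,20)` of the volumes 4050 / 4046 / 4080 at bucket `[220,246]`: 4·10⁴ … 8.3·10⁵ nodes at single orders).  Such an order is kernel-checked in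
`goIR` pieces (`AbelianSTPPCensusTAStatKMemberXSplit.lean`) assembled to the root, the order cover and the bucket walk (`AbelianSTPPCensusTAStatKMemberXWalk.lean`);
this file supplies the last, range-specific steps: `checkShape_of_walk` (the shape check of `AbelianSTPPCensusTAStatFDefs.lean` from its walk over the explicitly listed
table row), `TB5Stat.all_of_erase` + `checkV_one_of_all` (the volume's `checkV` at one order from the split shape(s) and the other shapes of the volume).
Bookkeeping only (equalities between Bool computations).
WHAT THIS IS NOT: arithmetic on shape lists only; no statement about STPP families or `ω`.
-/

set_option linter.dupNamespace false
set_option autoImplicit false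

namespace Summit.MatrixMultiplication.MatrixMultiplication.Theorems.TAStatF

open ShapeCert (gainOf2371j)
open TECert (vol us)
open TAStat (Entry)
open TAStatFData (E)

/-- `checkV` on a single volume from the `all` form [bookkeeping] -/
theorem checkV_one_of_all {Lo Hi V : ℕ} (h : (triplesS V).all (checkShape Lo Hi V (gainOf2371j V)) = true) :
    checkV Lo Hi 1 V = true := by
  show ((triplesS V).all (checkShape Lo Hi V (gainOf2371j V)) && checkV Lo Hi 0 (V + 1)) = true
  rw [h]; rfl

/-- a shape check from its bucket walk over the explicitly listed table row (the walk assembled bucket by bucket) [bookkeeping] -/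
theorem checkShape_of_walk {Lo Hi V : ℕ} {x : ℕ × ℕ × ℕ} {rw : List Entry}
    (hrow : (E.getD (levOf V) []).drop (bucketOf (x.1 * x.2.1)) = rw)
    (hw : walk (gainOf2371j V) (us x) V (2 * us x - (x.1 + x.2.1 + x.2.2)) x.1 (x.1 * x.2.1) (max Lo (V + 1)) Hi
      (bucketOf (x.1 * x.2.1)) rw (bucketOf (x.1 * x.2.1)) = true) :
    checkShape Lo Hi V (gainOf2371j V) x = true := by
  unfold checkShape; rw [hrow, hw]; simp

end Summit.MatrixMultiplication.MatrixMultiplication.Theorems.TAStatF
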